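/-
Copyright (c) 2026 the pub-hodgecm-mathlib formalisation cell (harness21).  Prover seat hodgecm-mathlib-K2E3-p37 (g3): Track B «K2-LIT»,
hLiu418 = stmt-HodgeConjecture-24832; LEAD F0P6-plan (g14) BATCH #149 (2) «(K1a-2d) ED. 2» under chair VALVE WORD W4; line lead K2E5-p16 (g8) WORD #7 (2)
(2026-09-04T23:45:27Z: «your (2d) edition is now ED. 3 … if > 400 l. with §1–§4b frozen: sibling `…LocalValueCMRecord` importing ★ (2d)» — this is that sibling).
-/
import Summits.HodgeConjecture.HodgeConjecture.Theorems.K2LiuRankOneSingularLocalValueCM          -- ★ p862811 ∕ p863212 (K1a-2d) ED. 1–2 (K2E5-p16 (g8)): §2 `…_eq_one_of_forall` (the per-place head, hypothesis-first)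
import Summits.HodgeConjecture.HodgeConjecture.Theorems.K2LiuRankOneSingularLocalValueGoodPlace   -- ★ p863217 (A′) (K2E3-p37 (g3)): the twisted value at a good place, generic datum, both place types
import Summits.HodgeConjecture.HodgeConjecture.Theorems.K2LiuRankOneCornerCharacterReading      -- ★ p862906 (K2E5-p16 (g8)): `exists_adaptedFrame_eq`, `conj_unipDeltaChar_single_locToAdelic_frameConj_nSiegel`
import Summits.HodgeConjecture.HodgeConjecture.Theorems.K2LiuSphericalSiegelValueCM              -- ★ (F-GK-4) ED. 2∕3: `exists_finset_forall_placeLetters_cm`, `exists_finset_forall_record_letters`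
import Summits.HodgeConjecture.HodgeConjecture.Theorems.K2LiuSiegelNormaliserTwoOfRecord        -- ★ E7 of record: `splitting_of_record`, `norm_localComponent_of_record` (+ ★ E7 §5 dictionary letters)
import HarnessLib

/-!
# Crux `HLiu418`, road `K2_Liu`, socket #41 KIND 1 a♮, organ (K1a-GK), file (K1a-2d) sibling ∕ ED. 3:
# THE TWISTED LOCAL FACTOR OF ★ G1 AT THE CORNER INDEX AND THE RECORD IS `c^{K1}_v(s) · Σ_{k ≤ ord_v τ} (ε_v q_v^{1−2s})^k`, OFF A FINITE SET OF PLACES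

Cell `hodgecm-mathlib`, crux item hLiu418 = `stmt-HodgeConjecture-24832`; squad K2 ∕ K2Liu; prover K2E3-p37 (g3) (W4 valve hand of LEAD F0P6-plan (g14), BATCH #149 (2));
line lead K2E5-p16 (g8) (WORD #5 `hK1a2`∕`hVal` bytes, WORD #7 (2) this cut); consumers (K1a-4) ED. 3 R90-C14-p02 (g0) `K2LiuRankOneSingularEulerContinued.exists_Eac_of_tprod_tail_cm`
(letter `hI = hK1a2 ∘ hVal`) and K2Liu-p12 (g5) ★ p863085 `K2LiuIncoherentRankOneUnramifiedRow.exists_unramifiedRow` (letter `hPval` at `s = ½`, after the (o1) junction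
`ord_v τ = ord_v (val₂ X)` ★ `K2LiuRankOneIndexValueTwoCorner.corner_eq_val₂_mul_norm`, K2E3-p25).  THEOREMS ONLY (no `def`, no instance, no notation, no named-fact hypothesis,
no `sorry`); lane `--supports stmt-HodgeConjecture-24832 --as helper` (count-neutral helper; closes no socket).

THE POINT ([KudlaRallis1994, §2], [Shimura1997, §18.4], [Tan1999, §4 Prop. 4.8]; census `CENSUS-K1a-GK` §1 (K2E5-p16)).  ★ (2d) ED. 1 §2–§3 carry the twisted local factor of
★ G1 at the CM datum HYPOTHESIS-FIRST on the twisted D10 value `hGK`; ★ (A′) evaluates that value at every good place of the generic doubled datum in ★ T1 letters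
(`vol · [lF(2s+1)∕lF(2s+2)]·[lEN(2s)∕lEN(2s+1)]·lF(2s)⁻¹·Σ_{k≤M}(unramValue χ_F · q^{1−2s})^k`, `M = ord τ`).  This file closes the loop at the corner index `S♭ = single 1 1 σ`:
* §1 the ORDER LETTER of the twist (`τ_v ∈ 𝔭^M ∖ 𝔭^{M+1}`, `M := (−log |τ_v|_v).toNat` — ★ p863085's `hm` currency) and the K1 RECORD DICTIONARY (★ E7 §5
  `aNorm_two_localComponent_eq_localScalar_cm`'s twin for KIND 1): for `χ|_{𝕀_{L⁺}} = ε`, `v` unramified in `L`, `χ_w` unramified above `v`, `0 < re s`,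
  **`[lF(2s+1)∕lF(2s+2)]·[lEN(2s)∕lEN(2s+1)]·lF(2s)⁻¹·Σ_{k≤M}(α q^{1−2s})^k = (1 − q_v^{−(2s+1)})(1 − ε_v q_v^{−(2s+2)})∕(1 − q_v^{−2s}) · Σ_{k≤M}(ε_v q_v^{1−2s})^k`**
  (`α = ε_v = ε(ϖ_v)` ★ `valueAtUniformizer_eq_prod_of_comp_ideleBaseChange`; split `α = 1`: `lEN = lF²` ★ `lEN_eq_of_split`; inert `α = −1`: `lEN(z) = (1 − q^{−z}q^{−z})⁻¹`
  ★ `lEN_eq_of_inert` — the middle reflection's `L(2s,ε)_v`, `L(2s+1,ε)_v` CANCEL against the outer ones, census §1);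
* §2 the `hGK` letter DISCHARGED at ONE place (generic `χ`; place letters as hypotheses): ★ (A′) `…_of_isGoodPlace` in the frame ★ `exists_adaptedFrame_eq` (`D⁻¹ = 2·W·gramR`),
  the twist read by ★ `conj_unipDeltaChar_single_locToAdelic_frameConj_nSiegel` as `ψ_v(b₁ · ι_v τ)`, `τ = t₁ · Tr_{L∕L⁺}(σδ)`, in ★ B4d-3's coordinates ★ `exists_homeomorph_coordTwo`;
* §3 AT THE RECORD `χ = toHeckeCharacter L lam⁻¹`, COFINITELY: **`∫ conj ψ_{S♭}(ι_v y) Λ_{s,v}((w_Δ)_v y) dν = [(1 − q_v^{−(2s+1)})(1 − ε_v q_v^{−(2s+2)})∕(1 − q_v^{−2s})] · Σ_{k ≤ ord_v τ}(ε_v q_v^{1−2s})^k`**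
  for `v ∉ T₀`, `ν(K∩N) = 1`, `1 < re s` (★ (2d) §2 `…_eq_one_of_forall` ∘ §2 ∘ §1, off `T₁ ∪ T₂ ∪ T₃` = place letters ★ `exists_finset_forall_placeLetters_cm` ∪ record letters
  ★ `exists_finset_forall_record_letters` ∪ `τ` non-integral).
HONEST LABEL.  `HC_CM` is proved only modulo the 7 printed citations (2 remaining named inputs: hLiu418 = `stmt-HodgeConjecture-24832`,
h413 = `stmt-HodgeConjecture-24833`) until rung 0 closes.  Count-neutral helper; closes no socket.

## References
* [KudlaRallis1994] S. Kudla, S. Rallis, *A regularized Siegel–Weil formula: the first term identity*, Ann. of Math. 140 (1994), §2.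
* [Shimura1997] G. Shimura, *Euler Products and Eisenstein Series*, CBMS 93 (1997), §18.4–18.5.
* [Tan1999] V. Tan, *Poles of Siegel Eisenstein series on U(n,n)*, Canad. J. Math. 51 (1999), §3, §4 Prop. 4.8.
* [Casselman1980] W. Casselman, Compositio Math. 40 (1980), §3 Thm. 3.1.   * [Tate1950] J. Tate (1950), §2.5, in Cassels–Fröhlich (1967) Ch. XV.
* [HarrisKudlaSweet1996] M. Harris, S. Kudla, W. J. Sweet, J. AMS 9 (1996), §1 (1.5), (1.11), §6 (6.14)–(6.16).
* [GelbartRogawski1991] S. Gelbart, J. Rogawski, Invent. Math. 105 (1991), §3.1 (3.1.3).   * [CasselsFrohlichANT1967] Cassels–Fröhlich (1967), Ch. II §10, §14; Ch. VII Prop. 1.2.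
-/

set_option autoImplicit false
set_option linter.dupNamespace false -- the mandated namespace repeats `HodgeConjecture.HodgeConjecture`

noncomputable section

open scoped NNReal ENNReal ComplexConjugate
open NumberField IsDedekindDomain Matrix MeasureTheory
open Literature.NumberTheory.GaloisRepresentations.IsNonarchimedeanLocalField
open Literature.NumberTheory.Automorphic Literature.NumberTheory.Automorphic.UnitaryGroup Literature.NumberTheory.GaloisRepresentations
open Literature.NumberTheory.GelbartRogawski1991 Literature.NumberTheory.GelbartRogawski1991.GRConstruction
open Literature.NumberTheory.GelbartRogawski1991.AdaptedBlocks
open Literature.NumberTheory.GelbartRogawski1991.UnitaryDualPair Literature.NumberTheory.GelbartRogawski1991.UnitaryDualPair.LocalSplitting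
open Literature.NumberTheory.K2Lit Literature.NumberTheory.K2Lit.SiegelDoubled Literature.NumberTheory.K2Lit.LocalSiegelDoubled
open Literature.Topology.Algebra.RestrictedProduct (inH)
open Summit.HodgeConjecture.HodgeConjecture.Cruxes.HLiu418.K2LiuSiegelUnipotentLocalDefs
open Summit.HodgeConjecture.HodgeConjecture.Cruxes.HLiu418.K2LiuSiegelUnipotentFourierDefs
open Summit.HodgeConjecture.HodgeConjecture.Cruxes.HLiu418.K2LiuSiegelUnipotentCharacters
open Summit.HodgeConjecture.HodgeConjecture.Cruxes.HLiu418.K2LiuLocalLFactorDefs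
open Summit.HodgeConjecture.HodgeConjecture.Cruxes.HLiu418.K2LiuRankOneSingularLocalValueCM (integral_conjChar_lambdaLoc_weylDelta_eq_one_of_forall)

namespace Summit.HodgeConjecture.HodgeConjecture.Cruxes.HLiu418.K2LiuRankOneSingularLocalValueCMRecord

/-! ## §1 The order letter of the twist and the K1 record dictionary -/

section OrderLetter

variable {K : Type} [Field K] [NumberField K] (v : HeightOneSpectrum (𝓞 K))

/-- **THE ORDER LETTER**: a non-zero `v`-integral `x ∈ K_v` lies in `𝔭^M ∖ 𝔭^{M+1}` for `M := (−log |x|_v).toNat` (`|x|_v = exp(log |x|_v)`, `log |x|_v ≤ 0`; ★ Lit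
`mem_primePowBall_adicCompletion_iff`) — ★ p863085's `hm` currency `(m : ℤ) = −log |val X|_v`. [cite: Tate1950, §2.5] [cite: CasselsFrohlichANT1967, Ch. II §10] -/
theorem mem_primePowBall_toNat_and_not_mem {x : v.adicCompletion K} (hx : x ≠ 0) (hx1 : Valued.v x ≤ 1) :
    x ∈ primePowBall (v.adicCompletion K) ((-WithZero.log (Valued.v x)).toNat : ℕ) ∧
      x ∉ primePowBall (v.adicCompletion K) (((-WithZero.log (Valued.v x)).toNat : ℕ) + 1) := by
  have hv0 : Valued.v x ≠ 0 := (Valuation.ne_zero_iff _).2 hx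
  have hlog : WithZero.log (Valued.v x) ≤ 0 := (WithZero.log_le_iff_le_exp hv0).2 (by rw [WithZero.exp_zero]; exact hx1)
  have hcast : (((-WithZero.log (Valued.v x)).toNat : ℕ) : ℤ) = -WithZero.log (Valued.v x) := Int.toNat_of_nonneg (by linarith)
  refine ⟨?_, fun h => ?_⟩
  · rw [mem_primePowBall_adicCompletion_iff, ← WithZero.log_le_iff_le_exp hv0, hcast, neg_neg]
  · rw [mem_primePowBall_adicCompletion_iff, ← WithZero.log_le_iff_le_exp hv0, hcast] at h
    linarith

end OrderLetter

section Dictionary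

open Literature.NumberTheory.Automorphic.Liu2021.LemD1IndexedNonVacuityInertCofinite (valued_toPlace_uniformizer_of_isUnramifiedIn)
open Summit.HodgeConjecture.HodgeConjecture.Cruxes.HLiu418.K2LiuGKRankOneIdentityLFactor (unramValue_chiF_eq_prod)
open Summit.HodgeConjecture.HodgeConjecture.Cruxes.HLiu418.K2LiuGoodPlaceWhittakerUnimodularValueCM (lEN_eq_of_split lEN_eq_of_inert)
open Summit.HodgeConjecture.HodgeConjecture.Cruxes.H413.K2E1HeckeCharBaseChangeLocalComponentsU (valueAtUniformizer_eq_prod_of_comp_ideleBaseChange)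
open Summit.HodgeConjecture.HodgeConjecture.Cruxes.H413.K2E1QuadraticHeckeCharCMPlaceValues

variable (L : Type) [Field L] [NumberField L] [IsCMField L] (v : HeightOneSpectrum (𝓞 (Fp L)))

omit [IsCMField L] in
/-- `‖q_v^{−z}‖ < 1` for `0 < re z`. [cite: Tate1950, §2.5] -/
theorem norm_residueCard_cpow_neg_lt_one {z : ℂ} (hz : 0 < z.re) : ‖(v.residueCard : ℂ) ^ (-z)‖ < 1 := by
  rw [Complex.norm_natCast_cpow_of_pos (lt_trans zero_lt_one v.one_lt_residueCard), Complex.neg_re]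
  exact Real.rpow_lt_one_of_one_lt_of_neg (by exact_mod_cast v.one_lt_residueCard) (neg_lt_zero.2 hz)

/-- `‖x‖ < 1 ⇒ 1 − x ≠ 0`, `1 + x ≠ 0`, `1 − x·x ≠ 0` (the side lines of the dictionary are empty on `0 < re`). [cite: Tate1950, §2.5] -/
theorem one_sub_ne_zero_and_of_norm_lt_one {x : ℂ} (hx : ‖x‖ < 1) : 1 - x ≠ 0 ∧ 1 + x ≠ 0 ∧ 1 - x * x ≠ 0 := by
  refine ⟨fun h => ?_, fun h => ?_, fun h => ?_⟩
  · have h1 : x = 1 := (sub_eq_zero.1 h).symm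
    rw [h1, norm_one] at hx; exact lt_irrefl _ hx
  · have h1 : x = -1 := eq_neg_of_add_eq_zero_right h
    rw [h1, norm_neg, norm_one] at hx; exact lt_irrefl _ hx
  · have h1 : x * x = 1 := (sub_eq_zero.1 h).symm
    have h2 : ‖x * x‖ < 1 := by rw [norm_mul]; nlinarith [norm_nonneg x]
    rw [h1, norm_one] at h2; exact lt_irrefl _ h2

/-- **THE K1 RECORD DICTIONARY** (★ E7 §5's twin for KIND 1 a♮).  `L` CM, `ε = ε_{L∕L⁺} =` ★ `quadraticHeckeCharCM L`, `χ` a Hecke character of `L` with `χ(a_L) = ε(a)` on `𝕀_{L⁺}`,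
`v` a finite place of `L⁺` unramified in `L`, `χ_w` unramified for `w ∣ v`, `0 < re s`, `M : ℕ`.  Then
**`[lF(2s+1)∕lF(2s+2)]·[lEN(2s)∕lEN(2s+1)]·lF(2s)⁻¹·Σ_{k≤M}(unramValue χ_F · q^{1−2s})^k = (1 − q_v^{−(2s+1)})(1 − ε(ϖ_v)q_v^{−(2s+2)})∕(1 − q_v^{−2s}) · Σ_{k≤M}(ε(ϖ_v) q_v^{1−2s})^k`**
— ★ (K1a-4) FILE 1 `hasProd_localScalarK1_cm`'s local factor `c^{K1}_v(s)` times the K1-a♮ polynomial of record (split `α = ε(ϖ_v) = 1`: `lEN = lF²`; inert `α = −1`: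
`lEN(z) = (1 − q_v^{−z}q_v^{−z})⁻¹ = [(1 − q_v^{−z})(1 − αq_v^{−z})]⁻¹`; the inert uniformiser ★ `valued_toPlace_uniformizer_of_isUnramifiedIn`).
[cite: HarrisKudlaSweet1996, §6 (6.14)–(6.16)] [cite: Tan1999, §4 Prop. 4.8] [cite: KudlaRallis1994, §2] [cite: CasselsFrohlichANT1967, Ch. VII Prop. 1.2] -/
theorem K1Value_localComponent_eq_localScalarK1_cm (χ : HeckeCharacter L)
    (hχε : ∀ a : ideleGroup (Fp L), χ (AdeleRing.ideleBaseChange (Fp L) L a) = quadraticHeckeCharCM L a)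
    (hχur : ∀ (w : UnitaryGroup.PlacesOver L v) (u : (w.1.adicCompletion L)ˣ), Valued.v (u : w.1.adicCompletion L) = 1 → χ.localComponent w.1 u = 1)
    (hunr : Algebra.IsUnramifiedIn (𝓞 L) v.asIdeal) (w₀ : UnitaryGroup.PlacesOver L v) {s : ℂ} (hs : 0 < s.re) (M : ℕ) :
    (lF (Fp L) L v (fun w : UnitaryGroup.PlacesOver L v => χ.localComponent w.1) (2 * s + 1) / lF (Fp L) L v (fun w : UnitaryGroup.PlacesOver L v => χ.localComponent w.1) (2 * s + 2)) * (lEN (Fp L) L (IsCMField.complexConj L) v (fun w : UnitaryGroup.PlacesOver L v => χ.localComponent w.1) (2 * s) / lEN (Fp L) L (IsCMField.complexConj L) v (fun w : UnitaryGroup.PlacesOver L v => χ.localComponent w.1) (2 * s + 1)) *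
          ((lF (Fp L) L v (fun w : UnitaryGroup.PlacesOver L v => χ.localComponent w.1) (2 * s))⁻¹ *
            ∑ k ∈ Finset.range (M + 1), (unramValue (Fp L) v (chiF (Fp L) L v (fun w : UnitaryGroup.PlacesOver L v => χ.localComponent w.1)) * (residueFieldCard (v.adicCompletion (Fp L)) : ℂ) ^ (1 - 2 * s)) ^ k) =
      (1 - (v.residueCard : ℂ) ^ (-(2 * s + 1))) * (1 - (quadraticHeckeCharCM L).valueAtUniformizer v * (v.residueCard : ℂ) ^ (-(2 * s + 2))) /
          (1 - (v.residueCard : ℂ) ^ (-(2 * s))) *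
          ∑ k ∈ Finset.range (M + 1), ((quadraticHeckeCharCM L).valueAtUniformizer v * (v.residueCard : ℂ) ^ (1 - 2 * s)) ^ k := by
  haveI : Algebra.IsQuadraticExtension (Fp L) L := IsCMField.isQuadraticExtension L
  have hπ := HeckeCharacter.valued_uniformizer (K := Fp L) v
  have hπw := valued_toPlace_uniformizer_of_isUnramifiedIn L v hunr
  have hϖ0 : ∀ w : UnitaryGroup.PlacesOver L v, UnitaryGroup.toPlace v w (HeckeCharacter.uniformizer (Fp L) v : v.adicCompletion (Fp L)) ≠ 0 := fun w h0 => by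
    have h1 := hπw w
    rw [h0, map_zero] at h1
    exact WithZero.zero_ne_coe h1
  have hαε : (((∏ w : UnitaryGroup.PlacesOver L v, χ.localComponent w.1 (Units.mk0 (UnitaryGroup.toPlace v w (HeckeCharacter.uniformizer (Fp L) v : v.adicCompletion (Fp L))) (hϖ0 w))) : ℂˣ) : ℂ) =
      (quadraticHeckeCharCM L).valueAtUniformizer v :=
    (valueAtUniformizer_eq_prod_of_comp_ideleBaseChange χ (quadraticHeckeCharCM L) hχε v hχur hπ hϖ0).symm
  have hq : (residueFieldCard (v.adicCompletion (Fp L)) : ℂ) = (v.residueCard : ℂ) := by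
    rw [Literature.NumberTheory.Automorphic.residueFieldCard_adicCompletion_eq (Fp L) v]
  -- the non-vanishing side letters on `0 < re`
  obtain ⟨hA1, hA2, hA3⟩ := one_sub_ne_zero_and_of_norm_lt_one (norm_residueCard_cpow_neg_lt_one L v (z := 2 * s) (by simp; linarith))
  obtain ⟨hB1, hB2, hB3⟩ := one_sub_ne_zero_and_of_norm_lt_one (norm_residueCard_cpow_neg_lt_one L v (z := 2 * s + 1) (by simp; linarith))
  obtain ⟨hC1, hC2, -⟩ := one_sub_ne_zero_and_of_norm_lt_one (norm_residueCard_cpow_neg_lt_one L v (z := 2 * s + 2) (by simp; linarith))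
  simp only [lF, lFactor_def]
  rw [unramValue_chiF_eq_prod (Fp L) L v (fun w : UnitaryGroup.PlacesOver L v => χ.localComponent w.1) hχur hπ hϖ0, hq]
  by_cases hw₀ : (IsCMField.complexConj L : L ≃ₐ[Fp L] L) • w₀.1 = w₀.1
  · -- inert: `α = ε(ϖ_v) = −1`, `lEN(z) = (1 − α² q^{−z} q^{−z})⁻¹`
    have hval : (quadraticHeckeCharCM L).valueAtUniformizer v = -1 := valueAtUniformizer_quadraticHeckeCharCM_of_nonsplit L v w₀ hw₀ hunr
    rw [lEN_eq_of_inert (Fp L) L (IsCMField.complexConj L) (complexConj_imagUnit L) (imagUnit_ne_zero L) v hπ hπw hχur hϖ0 w₀ hw₀ (2 * s),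
      lEN_eq_of_inert (Fp L) L (IsCMField.complexConj L) (complexConj_imagUnit L) (imagUnit_ne_zero L) v hπ hπw hχur hϖ0 w₀ hw₀ (2 * s + 1), hαε, hval]
    simp only [neg_one_mul, sub_neg_eq_add, neg_one_sq, one_mul]
    -- the four `q`-powers are independent atoms of a rational identity
    set A : ℂ := (v.residueCard : ℂ) ^ (-(2 * s)) with hA
    set B : ℂ := (v.residueCard : ℂ) ^ (-(2 * s + 1)) with hB
    set C : ℂ := (v.residueCard : ℂ) ^ (-(2 * s + 2)) with hC
    set D : ℂ := (v.residueCard : ℂ) ^ (1 - 2 * s) with hD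
    have e1 : (1 : ℂ) - A * A = (1 - A) * (1 + A) := by ring
    have e2 : (1 : ℂ) - B * B = (1 - B) * (1 + B) := by ring
    rw [e1, e2]
    field_simp
  · -- split: `α = ε(ϖ_v) = 1`, `lEN = lF²`
    have hval : (quadraticHeckeCharCM L).valueAtUniformizer v = 1 := valueAtUniformizer_quadraticHeckeCharCM_of_split L v w₀ hw₀
    rw [lEN_eq_of_split (Fp L) L (IsCMField.complexConj L) v hπw hχur hϖ0 w₀ hw₀ (2 * s),
      lEN_eq_of_split (Fp L) L (IsCMField.complexConj L) v hπw hχur hϖ0 w₀ hw₀ (2 * s + 1), hαε, hval]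
    simp only [one_mul]
    set A : ℂ := (v.residueCard : ℂ) ^ (-(2 * s)) with hA
    set B : ℂ := (v.residueCard : ℂ) ^ (-(2 * s + 1)) with hB
    set C : ℂ := (v.residueCard : ℂ) ^ (-(2 * s + 2)) with hC
    set D : ℂ := (v.residueCard : ℂ) ^ (1 - 2 * s) with hD
    field_simp

end Dictionary

/-! ## §2 The `hGK` letter discharged at one place, corner index, generic `χ` -/

section Discharge

open Summit.HodgeConjecture.HodgeConjecture.Cruxes.HLiu418.K2LiuDoubledUTwoTwoUnipotentHaar (exists_homeomorph_coordTwo)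
open Summit.HodgeConjecture.HodgeConjecture.Cruxes.HLiu418.K2LiuRankOneCornerCharacterReading (conj_unipDeltaChar_single_locToAdelic_frameConj_nSiegel)
open Summit.HodgeConjecture.HodgeConjecture.Cruxes.HLiu418.K2LiuRankOneSingularLocalValueGoodPlace (integral_addChar_mul_weylDelta_eq_of_isSphericalSection_of_isGoodPlace)

variable (L : Type) [Field L] [NumberField L] [IsCMField L] {N M : ℕ} (e : Fin N × Fin M ≃ Fin 2)
  (dV : Fin N → L) (hdV : ∀ i, IsCMField.complexConj L (dV i) = dV i)
  (dW : Fin M → L) (hdW : ∀ i, IsCMField.complexConj L (dW i) = dW i)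
  (v : HeightOneSpectrum (𝓞 (Fp L)))
  (D Dinv : Matrix (Fin 2) (Fin 2) (Fp L)) (hDD : D * Dinv = 1) (hDD' : Dinv * D = 1) (Q : GL (Fin (2 + 2)) (Fp L))
  (hQm : (Q : Matrix (Fin (2 + 2)) (Fin (2 + 2)) (Fp L)) = Matrix.reindex (e₂ 2) (e₂ 2) (Matrix.fromBlocks 1 D 1 (-D)))
  (hQ : (Q : Matrix (Fin (2 + 2)) (Fin (2 + 2)) (Fp L))ᵀ * LocalSplitting.gramD (Fp L) 2 (gramR L e dV hdV dW hdW) * (Q : Matrix (Fin (2 + 2)) (Fin (2 + 2)) (Fp L)) =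
    (StdForm.antidiagonal (2 + 2)).over (Fp L))
  (hDinv : Dinv = (2 : Fp L) • ((1 : Matrix (Fin 2) (Fin 2) (Fp L)).submatrix Fin.rev id * gramR L e dV hdV dW hdW))
  (hDw : ∀ (w : UnitaryGroup.PlacesOver L v) (i j : Fin 2),
    ValuativeRel.valuation (w.1.adicCompletion L) (algebraMap L (w.1.adicCompletion L) (algebraMap (Fp L) L (D i j))) ≤ 1)
  (hDiw : ∀ (w : UnitaryGroup.PlacesOver L v) (i j : Fin 2),
    ValuativeRel.valuation (w.1.adicCompletion L) (algebraMap L (w.1.adicCompletion L) (algebraMap (Fp L) L (Dinv i j))) ≤ 1)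
  (χ : HeckeCharacter L) (hχu : ∀ (w : UnitaryGroup.PlacesOver L v) (x : (w.1.adicCompletion L)ˣ), ‖((χ.localComponent w.1 x : ℂˣ) : ℂ)‖ = 1)
  (hgood : IsGoodPlace (Fp L) L (imagUnit L) v 2 (gramR L e dV hdV dW hdW) (fun w : UnitaryGroup.PlacesOver L v => χ.localComponent w.1))
  (σ : L) (hτ : gramR L e dV hdV dW hdW 1 1 * Algebra.trace (Fp L) L (σ * imagUnit L) ≠ 0)
  (hτv : Valued.v (algebraMap (Fp L) (v.adicCompletion (Fp L)) (gramR L e dV hdV dW hdW 1 1 * Algebra.trace (Fp L) L (σ * imagUnit L))) ≤ 1)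

include hDD hDD' hQm hQ hDinv hDw hDiw hχu hgood hτ hτv in
set_option maxHeartbeats 800000 in -- as ★ (2d) ED. 1 §2 (the CM datum's binder telescope: 200 000 ✗ `whnf` ∕ 800 000 ✓ there); structural `rw`∕`exact`
/-- **THE `hGK` LETTER AT ONE PLACE (corner index, generic `χ`).**  In the frame of ★ `exists_adaptedFrame_eq` (`D⁻¹ = 2·W·gramR`), at a good place `v` of the doubled CM datum for
`χ_v` (★ `IsGoodPlace`: `|2|_w = |δ|_w = 1`, `χ_w` unramified, `ψ_v` of conductor `𝒪_v`) with the frame integral, `χ_w` unitary, and the twist parameter `τ = t₁·Tr_{L∕L⁺}(σδ) ≠ 0`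
integral at `v` (`M := ord_v τ = (−log |ι_v τ|_v).toNat`): for every spherical section `f` of `I_v(s, χ_v)`, `1 < re s`, every Haar `νN` on ★ D10's `unipDeltaLocal`,
**`∫ conj ψ_{single 1 1 σ}(ι_v u) · f(w_Δ u) dνN(u) = νN{u | ↑u ∈ K_{H,v}} · [lF(2s+1)∕lF(2s+2)]·[lEN(2s)∕lEN(2s+1)]·lF(2s)⁻¹·Σ_{k≤M}(unramValue χ_F · q^{1−2s})^k`** — ★ (2d) §2's `hGK` binder at
`R vol := vol·(…)` (★ (A′) §3 in ★ B4d-3's coordinates ★ `exists_homeomorph_coordTwo`, the twist read by ★ `conj_unipDeltaChar_single_locToAdelic_frameConj_nSiegel` as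
`ψ_v(b₁ · ι_v τ)` with `ψ_v = adeleAddCharAt (Fp L) v` continuous of conductor `𝒪_v` = `hgood.psi`, and §1's order letter; both place types — ★ (2d) §4b is the non-split case by value).
[cite: KudlaRallis1994, §2] [cite: Shimura1997, §18.4] [cite: Casselman1980, §3 Thm. 3.1] [cite: Tate1950, §2.5] [cite: HarrisKudlaSweet1996, §1 (1.11), §6 (6.14)–(6.16)] -/
theorem integral_conjChar_single_mul_weylDelta_eq_of_isGoodPlace
    {_ : MeasurableSpace ↥(unipDeltaLocal (Fp L) L (IsCMField.complexConj L) v 2 (JD := hermD L e dV hdV dW hdW))} [BorelSpace ↥(unipDeltaLocal (Fp L) L (IsCMField.complexConj L) v 2 (JD := hermD L e dV hdV dW hdW))]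
    (νN : Measure ↥(unipDeltaLocal (Fp L) L (IsCMField.complexConj L) v 2 (JD := hermD L e dV hdV dW hdW))) [νN.IsHaarMeasure] {s : ℂ} (hs : 1 < s.re)
    {f : UnitaryGroup.localPi L (IsCMField.complexConj L) (2 + 2) (hermD L e dV hdV dW hdW) v → ℂ}
    (hf : haveI : Algebra.IsQuadraticExtension (Fp L) L := IsCMField.isQuadraticExtension L
      IsSphericalSection (Fp L) L (IsCMField.complexConj L) (complexConj_imagUnit L) (imagUnit_ne_zero L) (imagUnit_mul_self L) v 2 (gramR_isSymm L e dV hdV dW hdW) (hermD_eq_map_gramD L e dV hdV dW hdW) (fun w : UnitaryGroup.PlacesOver L v => χ.localComponent w.1) s f) :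
    haveI : Algebra.IsQuadraticExtension (Fp L) L := IsCMField.isQuadraticExtension L
    ∫ y, conj ((unipDeltaChar L e dV hdV dW hdW (Matrix.single 1 1 σ) (locToAdelic L e dV hdV dW hdW v (y : UnitaryGroup.localPi L (IsCMField.complexConj L) (2 + 2) (hermD L e dV hdV dW hdW) v)) : Circle) : ℂ) * f (weylDelta (Fp L) L (IsCMField.complexConj L) v 2 (hermD_eq_map_gramD L e dV hdV dW hdW) * (y : UnitaryGroup.localPi L (IsCMField.complexConj L) (2 + 2) (hermD L e dV hdV dW hdW) v)) ∂νN =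
      (νN.real {u | (u : UnitaryGroup.localPi L (IsCMField.complexConj L) (2 + 2) (hermD L e dV hdV dW hdW) v) ∈ UnitaryGroup.localInt L (IsCMField.complexConj L) (2 + 2) (hermD L e dV hdV dW hdW) v} : ℂ) *
        ((lF (Fp L) L v (fun w : UnitaryGroup.PlacesOver L v => χ.localComponent w.1) (2 * s + 1) / lF (Fp L) L v (fun w : UnitaryGroup.PlacesOver L v => χ.localComponent w.1) (2 * s + 2)) * (lEN (Fp L) L (IsCMField.complexConj L) v (fun w : UnitaryGroup.PlacesOver L v => χ.localComponent w.1) (2 * s) / lEN (Fp L) L (IsCMField.complexConj L) v (fun w : UnitaryGroup.PlacesOver L v => χ.localComponent w.1) (2 * s + 1)) *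
          ((lF (Fp L) L v (fun w : UnitaryGroup.PlacesOver L v => χ.localComponent w.1) (2 * s))⁻¹ *
            ∑ k ∈ Finset.range ((-WithZero.log (Valued.v (algebraMap (Fp L) (v.adicCompletion (Fp L)) (gramR L e dV hdV dW hdW 1 1 * Algebra.trace (Fp L) L (σ * imagUnit L))))).toNat + 1), (unramValue (Fp L) v (chiF (Fp L) L v (fun w : UnitaryGroup.PlacesOver L v => χ.localComponent w.1)) * (residueFieldCard (v.adicCompletion (Fp L)) : ℂ) ^ (1 - 2 * s)) ^ k)) := by
  haveI : Algebra.IsQuadraticExtension (Fp L) L := IsCMField.isQuadraticExtension L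
  -- ★ B4d-3's coordinates of `N_Δ(L⁺_v)` in the frame
  obtain ⟨e3, he3, he3add⟩ := exists_homeomorph_coordTwo (Fp L) L (IsCMField.complexConj L) (complexConj_imagUnit L) (imagUnit_ne_zero L) v
    (hermD_eq_map_gramD L e dV hdV dW hdW) D Dinv hDD hDD' Q hQm hQ
  -- the twist read in the coordinates: `conj ψ_{single 1 1 σ}(ι_v u) = ψ_v((e⁻¹u)₁ · ι_v τ)`
  have hchar : ∀ y : ↥(unipDeltaLocal (Fp L) L (IsCMField.complexConj L) v 2 (JD := hermD L e dV hdV dW hdW)),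
      conj ((unipDeltaChar L e dV hdV dW hdW (Matrix.single 1 1 σ) (locToAdelic L e dV hdV dW hdW v (y : UnitaryGroup.localPi L (IsCMField.complexConj L) (2 + 2) (hermD L e dV hdV dW hdW) v)) : Circle) : ℂ) =
        ((adeleAddCharAt (Fp L) v ((e3.symm y).1 * (algebraMap (Fp L) (v.adicCompletion (Fp L)) (gramR L e dV hdV dW hdW 1 1 * Algebra.trace (Fp L) L (σ * imagUnit L)))) : Circle) : ℂ) := by
    intro y
    obtain ⟨⟨b₁, z, b₂⟩, rfl⟩ := e3.surjective y
    rw [Homeomorph.symm_apply_apply, he3]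
    exact conj_unipDeltaChar_single_locToAdelic_frameConj_nSiegel L e dV hdV dW hdW v D Dinv hDD Q hQm hQ hDinv σ b₁ z b₂
  simp_rw [hchar]
  -- the order letter of the twist and ★ (A′) §3
  have hτv0 : (algebraMap (Fp L) (v.adicCompletion (Fp L)) (gramR L e dV hdV dW hdW 1 1 * Algebra.trace (Fp L) L (σ * imagUnit L))) ≠ 0 := by
    rw [map_ne_zero_iff _ (algebraMap (Fp L) (v.adicCompletion (Fp L))).injective]; exact hτ
  obtain ⟨hM, hM'⟩ := mem_primePowBall_toNat_and_not_mem v hτv0 hτv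
  exact integral_addChar_mul_weylDelta_eq_of_isSphericalSection_of_isGoodPlace (Fp L) L (IsCMField.complexConj L) (complexConj_imagUnit L) (imagUnit_ne_zero L)
    (imagUnit_mul_self L) v (gramR_isSymm L e dV hdV dW hdW) (hermD_eq_map_gramD L e dV hdV dW hdW) D Dinv hDD hDD' Q hQm hQ hDw hDiw e3 he3 he3add νN
    (fun w : UnitaryGroup.PlacesOver L v => χ.localComponent w.1) hχu (continuous_adeleAddCharAt (Fp L) v) hgood.psi hM hM' hgood hs hf

end Discharge

/-! ## §3 At the record `χ = toHeckeCharacter L lam⁻¹`: the twisted local factor IS `c^{K1}_v(s) · Σ_{k ≤ ord_v τ} (ε_v q_v^{1−2s})^k`, cofinitely -/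

section Record

open Literature.NumberTheory.Automorphic.IdeleClassGroup (IsConjugateSymplectic toHeckeCharacter)
open Summit.HodgeConjecture.HodgeConjecture.Cruxes.HLiu418.K2LiuSiegelNormaliserTwoOfRecord (splitting_of_record norm_localComponent_of_record)
open Summit.HodgeConjecture.HodgeConjecture.Cruxes.HLiu418.K2LiuSphericalSiegelValueCM (exists_finset_forall_placeLetters_cm exists_finset_forall_record_letters)
open Summit.HodgeConjecture.HodgeConjecture.Cruxes.HLiu418.K2LiuRankOneCornerCharacterReading (exists_adaptedFrame_eq)

variable (L : Type) [Field L] [NumberField L] [IsCMField L] {N M : ℕ} (e : Fin N × Fin M ≃ Fin 2)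
  (dV : Fin N → L) (hdV : ∀ i, IsCMField.complexConj L (dV i) = dV i)
  (dW : Fin M → L) (hdW : ∀ i, IsCMField.complexConj L (dW i) = dW i)
  [∀ v : HeightOneSpectrum (𝓞 (Fp L)), MeasurableSpace ↥(unipDeltaLoc L e dV hdV dW hdW v)]
  [∀ v : HeightOneSpectrum (𝓞 (Fp L)), BorelSpace ↥(unipDeltaLoc L e dV hdV dW hdW v)]

omit [IsCMField L] in
/-- **THE TWIST PARAMETER IS `v`-INTEGRAL COFINITELY**: for `τ ≠ 0` in `L⁺`, off a finite set of places `|ι_v τ|_v ≤ 1` (★ `eventually_valued_algebraMap_eq_one`: even `= 1`).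
[cite: CasselsFrohlichANT1967, Ch. II §14] -/
theorem exists_finset_forall_valued_algebraMap_le_one {τ : Fp L} (hτ : τ ≠ 0) :
    ∃ T₃ : Finset (HeightOneSpectrum (𝓞 (Fp L))), ∀ v ∉ T₃, Valued.v (algebraMap (Fp L) (v.adicCompletion (Fp L)) τ) ≤ 1 := by
  refine ⟨(Filter.eventually_cofinite.1 (UnitaryGroup.eventually_valued_algebraMap_eq_one (Fp L) hτ)).toFinset, fun v hv => ?_⟩
  have h : Valued.v (algebraMap (Fp L) (v.adicCompletion (Fp L)) τ) = 1 := by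
    by_contra h
    exact hv ((Set.Finite.mem_toFinset _).2 h)
  exact h.le

set_option maxHeartbeats 800000 in -- as ★ (2d) ED. 1 §3 (the statement repeats the CM telescope under the cofinite binders)
/-- **(K1a-2d) ED. 3 — THE TWISTED LOCAL FACTOR OF ★ G1 AT THE CORNER INDEX AND THE RECORD, OFF A FINITE SET OF PLACES (unconditional in `v`).**  For the doubled CM datum
`H = U(𝕎 ⊕ −𝕎)`, `𝕎 = V ⊗ W` of rank `2` with non-degenerate diagonal Gram data (`hdV0`, `hdW0`), `lam : C_L → S¹` conjugate-symplectic, `χ = toHeckeCharacter L lam⁻¹`, and a corner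
index `S♭ = single 1 1 σ` with `τ := t₁ · Tr_{L∕L⁺}(σδ) ≠ 0` (`t₁ = gramR 1 1`, `δ = imagUnit L`): there is a finite set `T₀` of finite places of `L⁺` such that for every `v ∉ T₀`, every
Haar measure `ν` on `N_Δ(L⁺_v) = unipDeltaLoc v` with ★ (E3)'s normalisation `ν(K_{H,v} ∩ N_Δ(L⁺_v)) = 1`, and every `1 < re s`,
**`∫ y, conj ψ_{S♭}(ι_v y) · Λ_{s,v}((w_Δ)_v · y) dν(y) = [(1 − q_v^{−(2s+1)})(1 − ε(ϖ_v) q_v^{−(2s+2)})∕(1 − q_v^{−2s})] · Σ_{k ∈ range (m v + 1)} (ε(ϖ_v) q_v^{1−2s})^k`**,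
`m v := (−log |ι_v τ|_v).toNat = ord_v τ` (`ε = ε_{L∕L⁺}`, `q_v = N v`) — the pointwise letter `hI` (`= hK1a2 ∘ hVal`) of ★ (K1a-4) ED. 2 `K2LiuRankOneSingularEulerContinued.exists_Eac_of_tprod_tail_cm`
with `P v s := Σ_{k≤m v}(ε_v q_v^{1−2s})^k` the polynomial of record (`= 1` where `m v = 0`), and at `s = ½` the `hPval` letter of ★ p863085 `exists_unramifiedRow` after the (o1) junction.
Proof: ★ (2d) §2 `…_eq_one_of_forall` at `R vol := vol·(…)` with `hGK` := §2 in the frame ★ `exists_adaptedFrame_eq`, off `T₁` (★ `exists_finset_forall_placeLetters_cm`) `∪ T₂` (★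
`exists_finset_forall_record_letters`) `∪ T₃` (`τ` integral); `hχu` ★ `norm_localComponent_of_record`; then §1's dictionary with `hχε` ★ `splitting_of_record`.
[cite: KudlaRallis1994, §2] [cite: Shimura1997, §18.4] [cite: Tan1999, §3; §4 Prop. 4.8] [cite: Casselman1980, §3 Thm. 3.1] [cite: HarrisKudlaSweet1996, §6 (6.14)–(6.16)] [cite: GelbartRogawski1991, §3.1 (3.1.3)] -/
theorem exists_finset_forall_integral_conjChar_lambdaLoc_weylDelta_eq_localScalarK1_of_record (hdV0 : ∀ i, dV i ≠ 0) (hdW0 : ∀ i, dW i ≠ 0)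
    {lam : IdeleClassGroup L →ₜ* Circle} (hlam : IsConjugateSymplectic L lam) (σ : L) (hτ : gramR L e dV hdV dW hdW 1 1 * Algebra.trace (Fp L) L (σ * imagUnit L) ≠ 0) :
    ∃ T₀ : Finset (HeightOneSpectrum (𝓞 (Fp L))), ∀ v ∉ T₀,
      ∀ (ν : Measure ↥(unipDeltaLoc L e dV hdV dW hdW v)) [ν.IsHaarMeasure],
        ν (((inH (fun v => UnitaryGroup.localInt L (IsCMField.complexConj L) (2 + 2) (hermD L e dV hdV dW hdW) v) (fun v => unipDeltaLoc L e dV hdV dW hdW v) v) :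
          Subgroup ↥(unipDeltaLoc L e dV hdV dW hdW v)) : Set ↥(unipDeltaLoc L e dV hdV dW hdW v)) = 1 →
        ∀ s : ℂ, 1 < s.re →
          ∫ y, conj ((unipDeltaChar L e dV hdV dW hdW (Matrix.single 1 1 σ) (locToAdelic L e dV hdV dW hdW v (y : UnitaryGroup.localPi L (IsCMField.complexConj L) (2 + 2) (hermD L e dV hdV dW hdW) v)) : Circle) : ℂ) * LambdaLoc L e dV hdV dW hdW v (toHeckeCharacter L lam⁻¹) s (UnitaryGroup.evalPlace (Fp L) L (IsCMField.complexConj L) (2 + 2) (hermD L e dV hdV dW hdW) v (UnitaryGroup.finPart (Fp L) L (IsCMField.complexConj L) (2 + 2) (hermD L e dV hdV dW hdW) (SiegelDoubled.weylDelta L e dV hdV dW hdW)) * (y : UnitaryGroup.localPi L (IsCMField.complexConj L) (2 + 2) (hermD L e dV hdV dW hdW) v)) ∂ν =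
            (1 - (v.residueCard : ℂ) ^ (-(2 * s + 1))) * (1 - (quadraticHeckeCharCM L).valueAtUniformizer v * (v.residueCard : ℂ) ^ (-(2 * s + 2))) /
          (1 - (v.residueCard : ℂ) ^ (-(2 * s))) *
          ∑ k ∈ Finset.range ((-WithZero.log (Valued.v (algebraMap (Fp L) (v.adicCompletion (Fp L)) (gramR L e dV hdV dW hdW 1 1 * Algebra.trace (Fp L) L (σ * imagUnit L))))).toNat + 1), ((quadraticHeckeCharCM L).valueAtUniformizer v * (v.residueCard : ℂ) ^ (1 - 2 * s)) ^ k := by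
  classical
  -- the frame of record with its blocks, the place letters, the record letters, the integrality of `τ`
  obtain ⟨D, Dinv, Q, hDD, hDD', hQm, hQ, -, hDinv⟩ :=
    exists_adaptedFrame_eq (Fp L) 2 (gramR_isSymm L e dV hdV dW hdW) (isUnit_det_gramR₀ L e dV hdV hdV0 dW hdW hdW0)
  obtain ⟨T₁, hT₁⟩ := exists_finset_forall_placeLetters_cm L e dV hdV dW hdW hdV0 hdW0 (toHeckeCharacter L lam⁻¹) D Dinv
  obtain ⟨T₂, hT₂⟩ := exists_finset_forall_record_letters L (toHeckeCharacter L lam⁻¹)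
  obtain ⟨T₃, hT₃⟩ := exists_finset_forall_valued_algebraMap_le_one L hτ
  refine ⟨T₁ ∪ T₂ ∪ T₃, fun v hv ν _ hνK s hs => ?_⟩
  rw [Finset.mem_union, Finset.mem_union, not_or, not_or] at hv
  obtain ⟨⟨hv₁, hv₂⟩, hv₃⟩ := hv
  obtain ⟨hgood, hDw, hDiw⟩ := hT₁ v hv₁
  obtain ⟨hχT, hχur, hunr⟩ := hT₂ v hv₂
  have hv1 := integral_conjChar_lambdaLoc_weylDelta_eq_one_of_forall L e dV hdV dW hdW v ν (Matrix.single 1 1 σ) (toHeckeCharacter L lam⁻¹) hχT s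
      (fun vol : ℝ => (vol : ℂ) * ((lF (Fp L) L v (fun w : UnitaryGroup.PlacesOver L v => (toHeckeCharacter L lam⁻¹).localComponent w.1) (2 * s + 1) / lF (Fp L) L v (fun w : UnitaryGroup.PlacesOver L v => (toHeckeCharacter L lam⁻¹).localComponent w.1) (2 * s + 2)) * (lEN (Fp L) L (IsCMField.complexConj L) v (fun w : UnitaryGroup.PlacesOver L v => (toHeckeCharacter L lam⁻¹).localComponent w.1) (2 * s) / lEN (Fp L) L (IsCMField.complexConj L) v (fun w : UnitaryGroup.PlacesOver L v => (toHeckeCharacter L lam⁻¹).localComponent w.1) (2 * s + 1)) *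
          ((lF (Fp L) L v (fun w : UnitaryGroup.PlacesOver L v => (toHeckeCharacter L lam⁻¹).localComponent w.1) (2 * s))⁻¹ *
            ∑ k ∈ Finset.range ((-WithZero.log (Valued.v (algebraMap (Fp L) (v.adicCompletion (Fp L)) (gramR L e dV hdV dW hdW 1 1 * Algebra.trace (Fp L) L (σ * imagUnit L))))).toNat + 1), (unramValue (Fp L) v (chiF (Fp L) L v (fun w : UnitaryGroup.PlacesOver L v => (toHeckeCharacter L lam⁻¹).localComponent w.1)) * (residueFieldCard (v.adicCompletion (Fp L)) : ℂ) ^ (1 - 2 * s)) ^ k))) hνK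
      (fun νN _ f hf => integral_conjChar_single_mul_weylDelta_eq_of_isGoodPlace L e dV hdV dW hdW v D Dinv hDD hDD' Q hQm hQ hDinv hDw hDiw
        (toHeckeCharacter L lam⁻¹) (norm_localComponent_of_record L lam v) hgood σ hτ (hT₃ v hv₃) νN hs hf)
  beta_reduce at hv1
  rw [hv1, Complex.ofReal_one, one_mul]
  exact K1Value_localComponent_eq_localScalarK1_cm L v (toHeckeCharacter L lam⁻¹) (splitting_of_record L hlam) hχur hunr
    (Classical.arbitrary (UnitaryGroup.PlacesOver L v)) (zero_lt_one.trans hs) _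

end Record

end Summit.HodgeConjecture.HodgeConjecture.Cruxes.HLiu418.K2LiuRankOneSingularLocalValueCMRecord

end
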